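import Summits.BirchSwinnertonDyer.Rank1Residual.X11b.KolyvaginReductionDatum
import Literature.NumberTheory.EllipticCurves.FrobeniusManinProofs

/-!
# Route `GenusKolyvaginAtTwo`, LINE 6, Q2 `KolyvaginRelationAtTwo`: McCallum's reduction datum at an
# inert prime WITHOUT `p` — the Frobenius equation on `Ẽ(\bar 𝔽_ℓ)` and its divisibility
# (helper, PROVED; seat `bsd-line-gk2-p2` g5, cell `bsd-f1-sign2`)

Sequel to `Theorems/GenusKolyvaginAtTwoKolyvaginRelationAtTwoCharpoly.lean` /
`…Orders.lean` (same seat), whose theorems prove McCallum 1991 Prop. 4.4 in order form at EVERY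
prime `p` from an abstract reduction datum in which the `p`-odd inputs of the tree's odd-`p` datum
(`±`-eigen-parts of `Frob(ℓ)` on `Ẽ(𝔽_λ)`, `2 ∈ (ℤ/p^M)^×`, Gross (3.2)/(3.4), the Weil pairing)
are replaced by two `p`-free properties of the reduction `B = Ẽ(\bar 𝔽_ℓ)`: the FROBENIUS EQUATION
`φ² − a_ℓ φ + ℓ = 0` on all of `B` and the `n`-DIVISIBILITY of `B`.

This file supplies that `p`-free datum for a globally minimal `E = W/ℚ` at a prime `ℓ ∤ Δ_W` inert
in a number field `K` (`λ` the unique place above `ℓ`, `q_λ = ℓ²`), a prime `𝔓 ∣ λ` of `\bar ℤ_K`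
and an arithmetic Frobenius `F` at `𝔓`:

* `exists_reductionDatum_of_charpoly` — there are `g ∈ Γ_K`, `red : E(K̄) → Ẽ(\bar 𝔽_ℓ)`
  (`= geomReduction ∘ θ⁻¹ ∘ g⁻¹`, the tree's reduction along the place `placeOver ℓ` transported,
  exactly as in the `b2b-bsdres` team's `KolyvaginH44.exists_reductionDatum`) and `φ = Frob_ℓ` with:
  `red` invariant under `I_𝔓`; `red ∘ F = φ² ∘ red`; `red` injective on `E[n]` (`ℓ ∤ n`);
  **`φ(φ b) + ℓ b = a_ℓ φ(b)` for every `b`** (Manin / Silverman V.2.3.1(b), tree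
  `frobenius_sq_sub_trace_smul_add_card_smul`, with `a_ℓ = ℓ + 1 − #Ẽ(𝔽_ℓ)`, tree
  `frobeniusTrace_eq_sub_natCard_reductionModPrime`); **`B` is `n`-divisible** (`red` is onto and
  `E(K̄)` is divisible). NO hypothesis on `p`, on `Frob(ℓ)` versus complex conjugation, or on the Weil
  pairing — so the odd-`p` X11b datum's inputs `p ≠ 2`, `exists_weilPairing`, `FrobEqFrobInfty`,
  `p ∣ ℓ + 1`, `p ∣ a_ℓ` are unnecessary for Prop. 4.4 at ANY `p` (they only fed the eigen-parts).

With `zsmul_kolyvaginClass_mem_selmerLocalKer_iff_of_zhangKolyvaginPrime` /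
`zsmul_kolyvaginClass_localOrders_of_zhangKolyvaginPrime` this leaves, for Q2 at `p = 2` (and for
McCallum Prop. 4.4 at every `p`), exactly the Heegner-point / ring-class inputs of the datum:
`F P_m = P_m` (λ splits completely in `K_m`), the inertia at `𝔓` acting on `E(K_{mℓ})` through
`⟨σ_ℓ⟩` (total ramification), the Euler-system root with Gross's congruence (Prop. 3.7), `P̃_{mℓ} =
t·φ(P̃_m)` — the same labelled inputs as the odd-`p` `h44` programme (`X11b/KolyvaginH44*`).
BSD is not proved by this; Q2 is not closed by this.

References: [SilvermanAEC2009] V.2.3.1(b), VII.2.1, VII.3.1(b), VII.4.1; [McCallumLMS1991] Prop. 4.4;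
[GrossLMS1991] Prop. 6.2 (2); [Serre1972] §1.11.
-/

set_option autoImplicit false
set_option linter.dupNamespace false

noncomputable section

open scoped Classical Pointwise

namespace Summit.BirchSwinnertonDyer.BirchSwinnertonDyer.Theorems.GenusExact

open WeierstrassCurve Field NumberField IsDedekindDomain
open Literature.NumberTheory.EllipticCurves Literature.NumberTheory.GaloisRepresentations
open Rat.HeightOneSpectrum
open Summit.BirchSwinnertonDyer.Rank1Residual.X11b.KolyvaginH44

universe u

variable {K : Type u} [Field K] [NumberField K]
  {ℓ : ℕ} [hℓ : Fact ℓ.Prime] (W : WeierstrassCurve ℚ) [W.IsGloballyMinimal] [W.IsElliptic]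
  (hΔ : ¬ (ℓ : ℤ) ∣ minimalDiscriminantInt W)

include hΔ in
/-- **McCallum's reduction datum at an inert prime, `p`-free form.** For a globally minimal
elliptic `E = W/ℚ`, a prime `ℓ ∤ Δ_W`, a place `v = λ` of the number field `K` which is the only
place above `ℓ` and has `q_λ = ℓ²`, a prime `𝔓 ∣ λ` of `\bar ℤ_K`, an arithmetic Frobenius `F` at
`𝔓`, and `n` with `ℓ ∤ n ≠ 0`: with `B = Ẽ(\bar 𝔽_ℓ)`, `red : E(K̄) → B` (the tree's
`geomReduction` along `placeOver ℓ`, transported along `E(K̄) ≃ E(ℚ̄)` and a `g ∈ Γ_K` moving the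
place to `𝔓`) and `φ = Frob_ℓ`: `red` is `I_𝔓`-invariant; `red ∘ F = φ² ∘ red`; `red` is injective on
`E[n]`; the Frobenius equation `φ(φ b) + ℓ b = a_ℓ φ(b)` holds on all of `B`; and `B` is
`n`-divisible. [cite: SilvermanAEC2009, Thm. V.2.3.1(b), Prop. VII.2.1, VII.3.1(b), VII.4.1]
[cite: McCallumLMS1991, Prop. 4.4 (proof)] -/
theorem exists_reductionDatum_of_charpoly
    {φ₀ : absoluteGaloisGroup (ZMod ℓ)} (hφ : ∀ x : AlgebraicClosure (ZMod ℓ), φ₀ • x = x ^ ℓ)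
    {v : HeightOneSpectrum (𝓞 K)} (hv : (ℓ : 𝓞 K) ∈ v.asIdeal)
    (huniq : ∀ w : HeightOneSpectrum (𝓞 K), (ℓ : 𝓞 K) ∈ w.asIdeal → w = v)
    (hres : v.residueCard = ℓ ^ 2)
    {𝔓 : Ideal (absIntegers (𝓞 K) K)} (h𝔓 : 𝔓 ∈ v.primesAbove)
    {n : ℕ} (hn : ¬ ℓ ∣ n) (hn0 : n ≠ 0) {F : absoluteGaloisGroup K}
    (hF : IsArithFrobAt (𝓞 K) F 𝔓) :
    ∃ (g : absoluteGaloisGroup K)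
      (red : geomPoints (W.baseChange K) →+ (reductionModPrime W ℓ).geomPoints)
      (φ : (reductionModPrime W ℓ).geomPoints →+ (reductionModPrime W ℓ).geomPoints),
      (∀ x, red x = geomReduction hΔ ((RatClosure.pointsEquiv (K := K) W).symm (g⁻¹ • x))) ∧
      (∀ b, φ b = φ₀ • b) ∧
      (∀ τ ∈ 𝔓.inertia (absoluteGaloisGroup K), ∀ x, red (τ • x) = red x) ∧
      (∀ x, red (F • x) = φ (φ (red x))) ∧
      (∀ x, (n : ℤ) • x = 0 → red x = 0 → x = 0) ∧
      (∀ b, φ (φ b) + (ℓ : ℤ) • b = W.frobeniusTrace ℓ • φ b) ∧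
      (∀ b : (reductionModPrime W ℓ).geomPoints, ∃ y : (reductionModPrime W ℓ).geomPoints,
        (n : ℤ) • y = b) := by
  haveI : (reductionModPrime W ℓ).IsElliptic := isElliptic_reductionModPrime W hΔ
  set θ := RatClosure.pointsEquiv (K := K) W with hθ
  -- the place `v₀ = (ℓ)` of `ℚ`, the prime `𝔓₀ = 𝔓 ∩ \bar ℤ`, the prime `𝔓pl` of the place
  obtain ⟨v₀, hv₀, hℓv₀⟩ := exists_ratPlace ℓ
  haveI := v.isPrime
  have hw : v.asIdeal.under (𝓞 ℚ) = v₀.asIdeal :=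
    Rat.under_eq_asIdeal_of_natCast_mem hℓ.out hℓv₀ hv
  set 𝔓₀ : Ideal (absIntegers (𝓞 ℚ) ℚ) := 𝔓.comap (absIntegersMap ℚ K) with h𝔓₀def
  have h𝔓₀ : 𝔓₀ ∈ v₀.primesAbove := comap_absIntegersMap_mem_primesAbove hw h𝔓
  obtain ⟨𝔓pl, hmem, h𝔓pl⟩ := exists_ideal_placeOver ℓ hv₀
  -- a `g ∈ Γ_K` with `res g • 𝔓pl = 𝔓₀`
  obtain ⟨𝔔, w, h𝔔c, hwv₀, h𝔔w⟩ := exists_place_comap_eq_smul (M := K) h𝔓pl 1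
  rw [one_smul] at h𝔔c
  have hwv : w = v := by
    refine huniq w ?_
    haveI := w.isPrime
    have : (ℓ : 𝓞 ℚ) ∈ w.asIdeal.under (𝓞 ℚ) := by rw [hwv₀]; exact hℓv₀
    rw [Ideal.under_def, Ideal.mem_comap, map_natCast] at this
    exact this
  subst hwv
  obtain ⟨g, hg⟩ := HeightOneSpectrum.exists_smul_eq_of_mem_primesAbove_holds h𝔔w h𝔓
  have hδ : absGaloisRestrict ℚ K g • 𝔓pl = 𝔓₀ := by
    rw [← h𝔔c, ← comap_absIntegersMap_smul, hg]
  -- the reduction along `𝔓₀`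
  obtain ⟨hI, hFr, hinj, hsurj⟩ := geomReduction_conj_datum hΔ hv₀ hmem h𝔓pl hδ hφ
  set red₀ : W.geomPoints →+ (reductionModPrime W ℓ).geomPoints :=
    (geomReduction hΔ).comp (DistribSMul.toAddMonoidHom W.geomPoints (absGaloisRestrict ℚ K g)⁻¹)
    with hred₀def
  have hred₀ : ∀ P, red₀ P = geomReduction hΔ ((absGaloisRestrict ℚ K g)⁻¹ • P) := fun P ↦ rfl
  set red : geomPoints (W.baseChange K) →+ (reductionModPrime W ℓ).geomPoints :=
    red₀.comp θ.symm.toAddMonoidHom with hreddef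
  have hred : ∀ Q, red Q = red₀ (θ.symm Q) := fun Q ↦ rfl
  set Φ : (reductionModPrime W ℓ).geomPoints →+ (reductionModPrime W ℓ).geomPoints :=
    DistribSMul.toAddMonoidHom _ φ₀ with hΦdef
  have hΦ : ∀ b, Φ b = φ₀ • b := fun b ↦ rfl
  -- ### `red ∘ F = φ² ∘ red`
  have hredF : ∀ x, red (F • x) = Φ (Φ (red x)) := by
    have hF' : ∀ x : absIntegers (𝓞 ℚ) ℚ,
        absGaloisRestrict ℚ K F • x - x ^ (ℓ ^ 2) ∈ 𝔓₀ := by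
      rw [forall_smul_sub_pow_mem_comap_iff ℚ K 𝔓 F (ℓ ^ 2), ← hres]
      exact (HeightOneSpectrum.isArithFrobAt_iff_of_mem_primesAbove h𝔓 F).mp hF
    obtain ⟨h', hh'⟩ := HeightOneSpectrum.exists_isArithFrobAt_of_mem_primesAbove_holds h𝔓₀
    have hq : v₀.residueCard = ℓ := by
      rw [Rat.residueCard_eq_natGenerator]; exact hv₀
    have hpow : ∀ x : absIntegers (𝓞 ℚ) ℚ, h' ^ 2 • x - x ^ (ℓ ^ 2) ∈ 𝔓₀ := fun x ↦ by
      have := smul_pow_sub_pow_mem_of_isArithFrobAt h𝔓₀ hh' 2 x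
      rwa [hq] at this
    set ι : absoluteGaloisGroup ℚ := absGaloisRestrict ℚ K F * (h' ^ 2)⁻¹ with hι
    have hιI : ι ∈ 𝔓₀.inertia (absoluteGaloisGroup ℚ) := by
      intro x
      change ι • x - x ∈ 𝔓₀
      set y := (h' ^ 2)⁻¹ • x with hy
      have hx : x = h' ^ 2 • y := by rw [hy, smul_inv_smul]
      have h1 : ι • x = absGaloisRestrict ℚ K F • y := by rw [hι, mul_smul]
      rw [h1, hx]
      have := sub_mem (hF' y) (hpow y)
      rwa [sub_sub_sub_cancel_right] at this
    have hιh : ι * h' ^ 2 = absGaloisRestrict ℚ K F := by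
      rw [hι, mul_assoc, inv_mul_cancel, mul_one]
    intro x
    rw [hred, hred, pointsEquiv_symm_smul, ← hιh, mul_smul, hI ι hιI, pow_two, mul_smul,
      hFr h' hh', hFr h' hh', hΦ, hΦ]
  -- ### the Frobenius equation on `Ẽ(\bar 𝔽_ℓ)` (Manin / Silverman V.2.3.1(b))
  have hcharB : ∀ b : (reductionModPrime W ℓ).geomPoints,
      Φ (Φ b) + (ℓ : ℤ) • b = W.frobeniusTrace ℓ • Φ b := by
    letI : Fintype (ZMod ℓ) := ZMod.fintype ℓ
    have hσ : ∀ x : AlgebraicClosure (ZMod ℓ), φ₀ • x = x ^ Nat.card (ZMod ℓ) := fun x ↦ by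
      rw [hφ x, Nat.card_zmod]
    have htr : HasseManin.tr (reductionModPrime W ℓ) = W.frobeniusTrace ℓ := by
      rw [HasseManin.tr, frobeniusTrace_eq_sub_natCard_reductionModPrime W ℓ, ZMod.card]
    intro b
    have h := (reductionModPrime W ℓ).frobenius_sq_sub_trace_smul_add_card_smul hσ b
    rw [htr, ZMod.card] at h
    rw [hΦ, hΦ, ← sub_eq_zero, ← h]
    abel
  -- ### `B` is `n`-divisible (`red` is onto, `E(K̄)` is divisible)
  have hnZ : (n : ℤ) ≠ 0 := by exact_mod_cast hn0
  have hdivB : ∀ b : (reductionModPrime W ℓ).geomPoints, ∃ y, (n : ℤ) • y = b := by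
    intro b
    obtain ⟨P, hP⟩ := hsurj b
    obtain ⟨Q, hQ⟩ := (W.baseChange K).zsmul_geomPoints_surjective_of_charZero hnZ (θ P)
    refine ⟨red Q, ?_⟩
    have hQ' : (n : ℤ) • Q = θ P := hQ
    rw [← map_zsmul, hQ', hred, AddEquiv.symm_apply_apply]
    exact hP
  refine ⟨g, red, Φ, fun x ↦ ?_, fun b ↦ rfl, ?_, hredF, ?_, hcharB, hdivB⟩
  · rw [hred, hred₀, pointsEquiv_symm_smul, map_inv]
  · -- inertia
    intro τ hτ x
    rw [hred, hred, pointsEquiv_symm_smul]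
    exact hI _ (absGaloisRestrict_mem_inertia_comap ℚ K hτ) _
  · -- injective on `E[n]`
    intro x hx h0
    rw [hred] at h0
    have hx' : n • θ.symm x = 0 := by rw [← natCast_zsmul, ← map_zsmul, hx, map_zero]
    have := hinj n hn _ hx' h0
    rw [← θ.symm.map_eq_zero_iff]
    exact this

end Summit.BirchSwinnertonDyer.BirchSwinnertonDyer.Theorems.GenusExact

end
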